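import Summits.ABC.IUTFork.Cor312NaiveProvPinnedThm311
import HarnessLib

/-!
# [IUTchIII] Cor. 3.12 — the TWO-PLACE bed, part I (REPAIR branch engine request E4): a two-place index and the
# weighted naive model of the typed Theorem 3.11 (volumes at EVERY place)

Record file (D-0012; abc-iut cell, REPAIR branch rung LADDER-ABC:A2.RP, seat abc-iut-rp-m4; «GO rp-m4 E4 TWO-PLACE bed»,
abc-iut-rp-plan 2026-08-26T08:18:35Z (6)). TAKES NO SIDE on [IUTchIII] Cor. 3.12 or on any author; MODEL DATA only (toy definitions),
no `Prop` fact, nothing asserted. Purpose: the row RP-M40 (`Repair/CandMochizuki40`, p431550) types S. Mochizuki's (LcGlIq)/(EssGlIq)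
([Rpt2024-03] `paper:url-b58939b9dc8f` p. 7 l. 32–44, p. 8 l. 11–26: «any essentially global inequality — i.e., such as … [IUTchIII],
Corollary 3.12 — can never be obtained … as a result of summing up local inequalities at each prime») as a LOCALITY TEST and proves
that on every ONE-PLACE index the typed Statement IS its local portion. Every model of record of the cell lives on a one-place index;
this part supplies the index-generic ingredients of a TWO-PLACE model:
* §1 `twoIndex`: two valuations over two rational places, both bad, `l⋆ = 2`.
* §2 the WEIGHTED naive model over ANY index skeleton `T`: abc-iut-w4-d026's index-generic naive model (`Cor312NaiveProvPinnedThm311`,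
  p428781: sign shells, splitting monoids `PsiOf θ`, Kummer twist `(−1)^m`, abc-iut-w5-d247's link data) with the ONE change that the
  cylinder log-volume `μ(B_k) = −k·w(v_ℚ)` is supported at EVERY place with a finitely supported weight `w` (w4-d026's `vol` is the case
  `w = c·𝟙_{v_ℚ⁰}`); the typed Theorem 3.11 (i) ∧ (ii) ∧ (iii) holds verbatim as there (`fullW_statement`; degree of `p^k𝒪` = `−k·Σ w`).
* §3 the two-place instance `twoFull p c` (weight `c` at both places, w4-d026's one-factor theta vectors) and its typed Thm. 3.11.
Part II (`Cor312TwoPlaceSetting`): the Cor.-3.12 setting with place-dependent log-shell inflation and the cells (Statement TRUE globally,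
local portion FALSE at the deep place, Licence / R3 / S FALSE). HONEST SCOPE: interface/toy level; standard axioms.
[claim: Mochizuki2012, status: disputed] [cite: ScholzeStix2018, §2.2 pp. 9–10]
-/

noncomputable section

open Set

namespace Summit.ABC.IUTFork.Cor312Vol.TwoPlace

open Thm311 Cor312 Cor312Vol NaiveProv Literature.IUT.LogThetaLattice

/-! ## 1. The two-place index -/

/-- **Two valuations over two rational places, both bad, `l⋆ = 2` (`l = 5`), everything nonarchimedean.** MODEL DATA. [folklore] -/
abbrev twoIndex : ThetaIndex where
  lstar := 2
  two_le_lstar := le_rfl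
  V := Fin 2
  VQ := Fin 2
  over := id
  IsNon := fun _ => True
  fibre_finite := fun _ => Set.toFinite _
  fibre_nonempty := fun vQ => ⟨vQ, rfl⟩
  Vbad := Set.univ
  Vbad_nonempty := ⟨0, trivial⟩
  Vbad_finite := Set.toFinite _
  Vbad_non := fun _ _ => trivial

/-! ## 2. The weighted naive model over any index skeleton (abc-iut-w4-d026's model, volumes at every place) -/

section Weighted

variable {T : ThetaIndex} (p : ℕ) (w : T.VQ → ℝ) (θ : ThetaFamily T)

/-- The WEIGHTED cylinder log-volume: `μ(B_k) = −k·w(v_ℚ)` at every place (w4-d026's `ballVol` with the place's weight as scale).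
MODEL DATA. [claim: Mochizuki2012, status: disputed] -/
def volW (j : T.Label) (vQ : T.VQ) (A : Set ((signShells T).Packet j vQ)) : ℝ := ballVol p (w vQ) j vQ A

variable [hp : Fact p.Prime]

/-- `μ(B_k) = −k·w(v_ℚ)`. [folklore] -/
theorem volW_pBall (j : T.Label) (vQ : T.VQ) (k : ℤ) : volW p w j vQ (pBall p j vQ k) = -(k : ℝ) * w vQ :=
  ballVol_pBall p (w vQ) j vQ k

/-- **Data (a)(b)(c)** of the weighted model: w4-d026's `dataOf` with the weighted log-volume. MODEL DATA. [claim: Mochizuki2012, status: disputed] -/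
def dataW : MRData (signShells T) where
  shellPk := fun j vQ => pBall p j vQ 0
  shellSub := fun j v => pBall p j (T.over v) 0
  Adm := fun j vQ A => ∃ k, A = pBall p j vQ k
  logvol := fun j vQ A => volW p w j vQ A
  Ψ := fun v _ => PsiOf θ v
  act := fun v _ y => LinearMap.pi fun j => (bcoord v j y) • LinearMap.proj j
  Mmod := fun _ => Set.univ

/-- The SITUATION of the weighted model (same data on every vertical line; global degrees `−k·Σ w`). MODEL DATA (an `abbrev`).
[claim: Mochizuki2012, status: disputed] -/
abbrev situationW : Situation T where
  L := signShells T
  D := fun _ => dataW p w θ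
  G := fun _ j => degrees p (∑ᶠ vQ, w vQ) j

/-- The COLUMN of the weighted model: w4-d026's `columnOf` with the weighted log-volume. MODEL DATA. [claim: Mochizuki2012, status: disputed] -/
def columnW : Column (signShells T) where
  frobAdm := fun m j vQ A => ∃ k, twist m j vQ '' A = pBall p j vQ k
  frobLogvol := fun m j vQ A => volW p w j vQ (twist m j vQ '' A)
  frobΨ := fun m v _ => (signShells T).starAut (twist m) v '' PsiOf θ v
  frobMmod := fun m j => (signShells T).globalAut (twist m) j.1 '' Set.univ
  unitImage := fun _ m' j vQ => pBall p j vQ ((m' : ℤ) + 1)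
  ballImage := fun _ j vQ => pBall p j vQ 0
  ObjLGP := ℤ
  frobObjLGP := NaiveWitness.FrobObj
  kumLGP := NaiveWitness.kum
  ObjLgp := ℤ
  frobObjLgp := NaiveWitness.FrobObj
  kumLgp := NaiveWitness.kum
  thetaPilot := fun m => ⟨(1, m), rfl⟩

/-- The FULL SITUATION of [IUTchIII] Thm. 3.11 in the weighted model (w5-d247's link data). MODEL DATA (an `abbrev`).
[claim: Mochizuki2012, status: disputed] -/
abbrev fullW : FullSituation T where
  toSituation := situationW p w θ
  col := fun _ => columnW p w θ
  link := NaiveWitness.naiveLink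

/-- (i) for the weighted model, for a finitely supported weight and theta vectors in the sub-packets: the degree of `p^k𝒪` IS the
global log-volume `−k·Σ_{v_ℚ} w(v_ℚ)` of its region. [folklore] -/
theorem partI_W (hw : (Function.support w).Finite)
    (hsub : ∀ (v : T.V), v ∈ T.Vbad → ∀ j : T.LabelStar, θ v j.1 ∈ (signShells T).SubPacket j.1 v) : (fullW p w θ).PartI := by
  refine ⟨fun n v hv x hx j => PsiOf_subPacket θ v (hsub v hv) hx j,
    fun n j (k : ℤ) => ⟨fun vQ => ⟨k, rfl⟩, ?_, ?_⟩, fun _ _ => rfl⟩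
  · refine hw.subset fun vQ hvQ => ?_
    rw [Function.mem_support]
    intro h0
    apply hvQ
    show volW p w j.1 vQ (pBall p j.1 vQ k) = 0
    rw [volW_pBall, h0, mul_zero]
  · show -(k : ℝ) * ∑ᶠ vQ, w vQ = ∑ᶠ vQ, volW p w j.1 vQ (pBall p j.1 vQ k)
    simp_rw [volW_pBall]
    exact mul_finsum (fun vQ => w vQ) _

omit hp in
/-- (ii) for the weighted model (w4-d026's proof verbatim: the twist fixes cylinders, sign-saturation, onto, (Ind3)). [folklore] -/
theorem partII_W : (fullW p w θ).toLatticeSituation.PartII := by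
  intro n
  refine (Column.partII_iff _ _).2 ⟨?_, fun m v hv => image_PsiOf_twist θ m v,
    fun m j => Set.image_univ_of_surjective ((signShells T).globalAut (twist m) j.1).surjective, ?_, ?_⟩
  · rintro m j vQ A ⟨k, rfl⟩
    exact ⟨⟨k, image_pBall_twist p m j vQ k⟩, by
      show volW p w j vQ (twist m j vQ '' pBall p j vQ k) = volW p w j vQ (pBall p j vQ k)
      rw [image_pBall_twist]⟩
  · exact fun m m' j vQ _ => pBall_mono p j vQ (by omega)
  · intro m j vQ _
    exact ⟨pBall_mono p j vQ (by norm_num), subset_rfl, fun m' _ => pBall_mono p j vQ (by omega)⟩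

omit hp in
/-- (iii) for the weighted model (w4-d026's proof verbatim). [folklore] -/
theorem partIII_W : (fullW p w θ).PartIII := by
  refine ⟨NaiveWitness.naiveLink.partIIIa_holds, NaiveWitness.naiveLink.partIIIb_holds, ?_, ?_,
    (fullW p w θ).evalCompatUpToInd_of_multiradialCompat fun _ _ => rfl⟩
  · refine NaiveWitness.naiveLink.partIIIc_of_full (fun _ => rfl) fun n m => ?_
    rintro _ ⟨a, rfl⟩
    show NaiveWitness.unitIso a ≪≫ NaiveWitness.unitIso ((-1) ^ m.natAbs) =
      NaiveWitness.unitIso ((-1) ^ m.natAbs) ≪≫ NaiveWitness.unitIso a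
    rw [NaiveWitness.unitIso_trans, NaiveWitness.unitIso_trans, mul_comm]
  · intro n m; exact Thm311.PolyIsoCalc.stabilized_full _ _

/-- **The typed Theorem 3.11 (i) ∧ (ii) ∧ (iii) HOLDS in the weighted model** (finitely supported weight, theta vectors in the
sub-packets). [folklore] -/
theorem fullW_statement (hw : (Function.support w).Finite)
    (hsub : ∀ (v : T.V), v ∈ T.Vbad → ∀ j : T.LabelStar, θ v j.1 ∈ (signShells T).SubPacket j.1 v) : (fullW p w θ).Statement :=
  ⟨partI_W p w θ hw hsub, partII_W p w θ, partIII_W p w θ⟩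

end Weighted

/-! ## 3. The two-place full situation -/

section TwoFull

variable (p : ℕ) (c : ℝ)

/-- The two-place full situation: weight `c` at BOTH places, w4-d026's one-factor theta vectors. MODEL DATA (an `abbrev`).
[claim: Mochizuki2012, status: disputed] -/
abbrev twoFull : FullSituation twoIndex := fullW p (fun _ => c) (thetaVec1 (T := twoIndex) p)

/-- The typed Theorem 3.11 holds in the two-place model. [folklore] -/
theorem twoFull_statement [Fact p.Prime] : (twoFull p c).Statement :=
  fullW_statement p _ _ (Set.toFinite _) fun v _ j => thetaVec1_mem_subPacket p v j.1

end TwoFull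

end Summit.ABC.IUTFork.Cor312Vol.TwoPlace

end
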